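import Mathlib
import Summits.NavierStokesRegularity.NavierStokesRegularity.Theorems.FilamentSkeletonRssStadiumDeviationPackage

/-!
# The `1/n`-disc deviation package at a stadium point, any ratio `n > 1`, height `t ≥ 0` (`TangentSkeletonNearStraightL`,
# stmt-NavierStokesRegularity-23320, registered stub `stub_stripPropagation`)

`Theorems.StadiumDeviationPackage` fixed the disc ratio `7` (output half-width `cs√Γ/8`).  The repair census of this generation
(evidence `DIAG-stripPropagation-ends-g2.md` on 23320) recommends the output half-width `cs√Γ/16` with ratio `14`, and the end staircase mixes
ratios; so here the same package is stated for an arbitrary real ratio `n > 1` and for `t ≥ 0` (at `t = 0` the deviations vanish):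
if `n·t < hs` and `|x − cc| + n·t < L + hs` then
* `deviation_ratio` : `‖F′(x+it) − F′(x)‖ ≤ M·log(n/(n−1))`, `|Re F′ᵢ(x+it) − Re F′ᵢ(x)| ≤ 2M(log(n/(n−1)) − 1/n)`;
* `euclid_im_le_ratio`, `euclid_re_dev_le_ratio` : the Euclidean forms (`×√3`) against the real unit tangent `⟪X′(x), eᵢ⟫`;
* `log_ratio_le` : `log(n/(n−1)) ≤ 1/(n−1)`, `inv_le_log_ratio` : `1/n ≤ log(n/(n−1))`.
With `M = 2`, `n = 14`: `q ≤ 2√3·log(14/13) ≤ 2√3/13 < 0.267`, `e ≤ 4√3(1/13 − 1/14) < 0.039`.  HONEST FRAMING: a tool for a HYPOTHETICAL filament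
skeleton on the NEGATIVE side of a MODEL route; nothing here bears on Navier–Stokes regularity or blow-up.  `--supports stmt-NavierStokesRegularity-23320`.
-/

set_option linter.dupNamespace false

noncomputable section

namespace Summit.NavierStokesRegularity.NavierStokesRegularity.Theorems.StadiumDeviationRatio

open Set Metric
open scoped InnerProductSpace
open Summit.NavierStokesRegularity.NavierStokesRegularity.Theorems.StadiumTangentDeviation
open Summit.NavierStokesRegularity.NavierStokesRegularity.Theorems.StadiumDeviationPackage

/-- `log(n/(n−1)) ≤ 1/(n−1)` for `n > 1`. [folklore] -/
theorem log_ratio_le {n : ℝ} (hn : 1 < n) : Real.log (n / (n - 1)) ≤ 1 / (n - 1) := by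
  have hn1 : 0 < n - 1 := by linarith
  have h := Real.log_le_sub_one_of_pos (show (0:ℝ) < n / (n - 1) by positivity)
  have e : n / (n - 1) - 1 = 1 / (n - 1) := by field_simp; ring
  linarith [e]

/-- `1/n ≤ log(n/(n−1))` for `n > 1` (so the second-order constant `log(n/(n−1)) − 1/n` is nonnegative). [folklore] -/
theorem inv_le_log_ratio {n : ℝ} (hn : 1 < n) : 1 / n ≤ Real.log (n / (n - 1)) := by
  have hn1 : 0 < n - 1 := by linarith
  have hn0 : 0 < n := by linarith
  have h := Real.one_sub_inv_le_log_of_pos (show (0:ℝ) < n / (n - 1) by positivity)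
  have e : 1 - (n / (n - 1))⁻¹ = 1 / n := by field_simp; ring
  linarith [e]

/-- **The `1/n`-disc deviation bounds at a stadium point**, `t ≥ 0`.  See the module docstring. [folklore] -/
theorem deviation_ratio {hs L cc M : ℝ} {F : ℂ → (Fin 3 → ℂ)}
    (hF : DifferentiableOn ℂ F {z : ℂ | |z.im| < hs ∧ |z.re - cc| < L + hs})
    (hM : ∀ z ∈ {z : ℂ | |z.im| < hs ∧ |z.re - cc| < L + hs}, ‖deriv F z‖ ≤ M)
    {X : ℝ → EuclideanSpace ℝ (Fin 3)}
    (hFX : ∀ r : ℝ, (r : ℂ) ∈ {z : ℂ | |z.im| < hs ∧ |z.re - cc| < L + hs} →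
      F r = fun i => ((⟪X r, EuclideanSpace.single i (1:ℝ)⟫_ℝ : ℝ) : ℂ))
    {n x t : ℝ} (hn : 1 < n) (ht : 0 ≤ t) (hfit : n * t < hs) (hfit' : |x - cc| + n * t < L + hs) (hhs : 0 < hs)
    (hx : |x - cc| < L + hs) (i : Fin 3) :
    ‖deriv F ((x : ℂ) + (t : ℂ) * Complex.I) - deriv F (x : ℂ)‖ ≤ M * Real.log (n / (n - 1)) ∧
    |(deriv F ((x : ℂ) + (t : ℂ) * Complex.I) i).re - (deriv F (x : ℂ) i).re| ≤ 2 * M * (Real.log (n / (n - 1)) - 1 / n) := by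
  set S : Set ℂ := {z : ℂ | |z.im| < hs ∧ |z.re - cc| < L + hs} with hS
  have hSo : IsOpen S := by
    have h1 : IsOpen {z : ℂ | |z.im| < hs} := isOpen_lt (continuous_abs.comp Complex.continuous_im) continuous_const
    have h2 : IsOpen {z : ℂ | |z.re - cc| < L + hs} :=
      isOpen_lt (continuous_abs.comp (Complex.continuous_re.sub continuous_const)) continuous_const
    exact h1.inter h2
  have hn0 : 0 < n := by linarith
  -- `M ≥ 0` (from the bound at the real point `x`)
  have hxS : (x : ℂ) ∈ S := ⟨by simpa using hhs, by simpa using hx⟩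
  have hM0 : 0 ≤ M := (norm_nonneg _).trans (hM _ hxS)
  have hlog0 : 0 ≤ Real.log (n / (n - 1)) := le_trans (by positivity) (inv_le_log_ratio hn)
  have hlog1 : 0 ≤ Real.log (n / (n - 1)) - 1 / n := by linarith [inv_le_log_ratio hn]
  rcases ht.eq_or_lt with h0 | htpos
  · -- `t = 0`: nothing to prove
    rw [← h0]
    simp only [Complex.ofReal_zero, zero_mul, add_zero, sub_self, norm_zero, abs_zero]
    exact ⟨by positivity, by positivity⟩
  · have hdisc : ∀ u ∈ Icc (0:ℝ) t, closedBall ((x : ℂ) + (u : ℂ) * Complex.I) (n * t - u) ⊆ S := by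
      intro u hu
      exact closedBall_subset_stadium hu.1 (by linarith) (by linarith [hu.1])
    have htR : t < n * t := by nlinarith
    have hlog : Real.log (n * t / (n * t - t)) = Real.log (n / (n - 1)) := by
      congr 1
      have hne : n * t - t ≠ 0 := by nlinarith
      have hne' : n - 1 ≠ 0 := by linarith
      rw [div_eq_div_iff hne hne']
      ring
    have hrat : t / (n * t) = 1 / n := by field_simp
    refine ⟨?_, ?_⟩
    · have h := norm_deriv_vertical_sub_le hSo hF hM ht htR hdisc
      rwa [hlog] at h
    · have hab : ∀ r ∈ Ioo (cc - (L + hs)) (cc + (L + hs)), (r : ℂ) ∈ S := by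
        intro r hr
        refine ⟨by simpa using hhs, ?_⟩
        simp only [Complex.ofReal_re]
        rw [abs_lt]; constructor <;> linarith [hr.1, hr.2]
      have hx' : x ∈ Ioo (cc - (L + hs)) (cc + (L + hs)) := by
        rw [abs_lt] at hx; constructor <;> linarith
      have hreal : ∀ r ∈ Ioo (cc - (L + hs)) (cc + (L + hs)), ∀ i, (F r i).im = 0 := by
        intro r hr j
        rw [hFX r (hab r hr)]
        exact Complex.ofReal_im _
      have h := abs_re_deriv_vertical_sub_le hSo hF hM hx' hab hreal ht htR hdisc i
      rwa [hlog, hrat] at h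

/-- **Euclidean imaginary deviation, ratio `n`**: `√Σ (Im F′ᵢ(x+it))² ≤ √3·M·log(n/(n−1))`. [folklore] -/
theorem euclid_im_le_ratio {hs L cc M : ℝ} {F : ℂ → (Fin 3 → ℂ)}
    (hF : DifferentiableOn ℂ F {z : ℂ | |z.im| < hs ∧ |z.re - cc| < L + hs})
    (hM : ∀ z ∈ {z : ℂ | |z.im| < hs ∧ |z.re - cc| < L + hs}, ‖deriv F z‖ ≤ M)
    {X : ℝ → EuclideanSpace ℝ (Fin 3)} (hX : Differentiable ℝ X)
    (hFX : ∀ r : ℝ, (r : ℂ) ∈ {z : ℂ | |z.im| < hs ∧ |z.re - cc| < L + hs} →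
      F r = fun i => ((⟪X r, EuclideanSpace.single i (1:ℝ)⟫_ℝ : ℝ) : ℂ))
    {n x t : ℝ} (hn : 1 < n) (ht : 0 ≤ t) (hfit : n * t < hs) (hfit' : |x - cc| + n * t < L + hs) (hhs : 0 < hs)
    (hx : |x - cc| < L + hs) :
    √(∑ i, (deriv F ((x : ℂ) + (t : ℂ) * Complex.I) i).im ^ 2) ≤ √3 * (M * Real.log (n / (n - 1))) := by
  have hcomp : ∀ i, |(deriv F ((x : ℂ) + (t : ℂ) * Complex.I) i).im| ≤ M * Real.log (n / (n - 1)) := by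
    intro i
    have h1 := (deviation_ratio hF hM hFX hn ht hfit hfit' hhs hx i).1
    have h0 := (deriv_real_point hF hX hFX hhs hx i).2
    have e : (deriv F ((x : ℂ) + (t : ℂ) * Complex.I) i).im =
        ((deriv F ((x : ℂ) + (t : ℂ) * Complex.I) - deriv F (x : ℂ)) i).im := by
      simp [Pi.sub_apply, Complex.sub_im, h0]
    rw [e]
    exact ((Complex.abs_im_le_norm _).trans (norm_le_pi_norm _ i)).trans h1
  have hM0 : 0 ≤ M * Real.log (n / (n - 1)) := (abs_nonneg _).trans (hcomp 0)
  have hsum : ∑ i, (deriv F ((x : ℂ) + (t : ℂ) * Complex.I) i).im ^ 2 ≤ 3 * (M * Real.log (n / (n - 1))) ^ 2 :=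
    calc ∑ i, (deriv F ((x : ℂ) + (t : ℂ) * Complex.I) i).im ^ 2 ≤ ∑ _i : Fin 3, (M * Real.log (n / (n - 1))) ^ 2 :=
          Finset.sum_le_sum fun i _ => sq_le_sq' (by linarith [neg_abs_le ((deriv F ((x : ℂ) + (t : ℂ) * Complex.I) i).im), hcomp i])
            ((le_abs_self _).trans (hcomp i))
      _ = 3 * (M * Real.log (n / (n - 1))) ^ 2 := by simp
  calc √(∑ i, (deriv F ((x : ℂ) + (t : ℂ) * Complex.I) i).im ^ 2) ≤ √(3 * (M * Real.log (n / (n - 1))) ^ 2) :=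
        Real.sqrt_le_sqrt hsum
    _ = √3 * (M * Real.log (n / (n - 1))) := by rw [Real.sqrt_mul (by norm_num), Real.sqrt_sq hM0]

/-- **Euclidean real-part deviation from the real tangent, ratio `n`**: `√Σ (Re F′ᵢ(x+it) − ⟪X′(x), eᵢ⟫)² ≤ √3·2M(log(n/(n−1)) − 1/n)`. [folklore] -/
theorem euclid_re_dev_le_ratio {hs L cc M : ℝ} {F : ℂ → (Fin 3 → ℂ)}
    (hF : DifferentiableOn ℂ F {z : ℂ | |z.im| < hs ∧ |z.re - cc| < L + hs})
    (hM : ∀ z ∈ {z : ℂ | |z.im| < hs ∧ |z.re - cc| < L + hs}, ‖deriv F z‖ ≤ M)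
    {X : ℝ → EuclideanSpace ℝ (Fin 3)} (hX : Differentiable ℝ X)
    (hFX : ∀ r : ℝ, (r : ℂ) ∈ {z : ℂ | |z.im| < hs ∧ |z.re - cc| < L + hs} →
      F r = fun i => ((⟪X r, EuclideanSpace.single i (1:ℝ)⟫_ℝ : ℝ) : ℂ))
    {n x t : ℝ} (hn : 1 < n) (ht : 0 ≤ t) (hfit : n * t < hs) (hfit' : |x - cc| + n * t < L + hs) (hhs : 0 < hs)
    (hx : |x - cc| < L + hs) :
    √(∑ i, ((deriv F ((x : ℂ) + (t : ℂ) * Complex.I) i).re - ⟪deriv X x, EuclideanSpace.single i (1:ℝ)⟫_ℝ) ^ 2) ≤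
      √3 * (2 * M * (Real.log (n / (n - 1)) - 1 / n)) := by
  have hcomp : ∀ i, |(deriv F ((x : ℂ) + (t : ℂ) * Complex.I) i).re - ⟪deriv X x, EuclideanSpace.single i (1:ℝ)⟫_ℝ| ≤
      2 * M * (Real.log (n / (n - 1)) - 1 / n) := by
    intro i
    have h1 := (deviation_ratio hF hM hFX hn ht hfit hfit' hhs hx i).2
    have h0 := (deriv_real_point hF hX hFX hhs hx i).1
    rw [← h0]; exact h1
  have hM0 : 0 ≤ 2 * M * (Real.log (n / (n - 1)) - 1 / n) := (abs_nonneg _).trans (hcomp 0)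
  have hsum : ∑ i, ((deriv F ((x : ℂ) + (t : ℂ) * Complex.I) i).re - ⟪deriv X x, EuclideanSpace.single i (1:ℝ)⟫_ℝ) ^ 2 ≤
      3 * (2 * M * (Real.log (n / (n - 1)) - 1 / n)) ^ 2 :=
    calc ∑ i, ((deriv F ((x : ℂ) + (t : ℂ) * Complex.I) i).re - ⟪deriv X x, EuclideanSpace.single i (1:ℝ)⟫_ℝ) ^ 2
          ≤ ∑ _i : Fin 3, (2 * M * (Real.log (n / (n - 1)) - 1 / n)) ^ 2 :=
          Finset.sum_le_sum fun i _ => sq_le_sq'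
            (by linarith [neg_abs_le ((deriv F ((x : ℂ) + (t : ℂ) * Complex.I) i).re -
              ⟪deriv X x, EuclideanSpace.single i (1:ℝ)⟫_ℝ), hcomp i])
            ((le_abs_self _).trans (hcomp i))
      _ = 3 * (2 * M * (Real.log (n / (n - 1)) - 1 / n)) ^ 2 := by simp
  calc √(∑ i, ((deriv F ((x : ℂ) + (t : ℂ) * Complex.I) i).re - ⟪deriv X x, EuclideanSpace.single i (1:ℝ)⟫_ℝ) ^ 2)
        ≤ √(3 * (2 * M * (Real.log (n / (n - 1)) - 1 / n)) ^ 2) := Real.sqrt_le_sqrt hsum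
    _ = √3 * (2 * M * (Real.log (n / (n - 1)) - 1 / n)) := by rw [Real.sqrt_mul (by norm_num), Real.sqrt_sq hM0]

end Summit.NavierStokesRegularity.NavierStokesRegularity.Theorems.StadiumDeviationRatio

end
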